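import Literature.AnabelianGeometry.EtaleTheta.KummerContH1Injective
import Literature.AnabelianGeometry.EtaleTheta.EtaleThetaClass
import Literature.AnabelianGeometry.EtaleTheta.KummerFieldUnits
import HarnessLib

/-!
# Kummer data on a theta setting from a cyclotome identification `Ẑ(1) ≅ Δ_Θ` (construction)

Mochizuki, *The étale theta function …*, Publ. RIMS **45** (2009) [EtTh], §1, Prop. 1.3 / 1.5, PRIMS PDF
pp. 21–23 [cite: MochizukiEtTh2009, Prop 1.5 p.23]: "the composite of the Kummer map `O^×_K̈ → H¹(G_K̈, Δ_Θ)`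
with the natural map `H¹(G_K̈, Δ_Θ) → H¹(Π^tp_Ÿ, Δ_Θ)`", "`F² = H¹(G_K, Δ_Θ) →̃ H¹(G_K, Ẑ(1)) →̃ (K^×)^∧`".

CLASS (b) CONSTRUCTION over the frozen interface (abc-iut cell, ROW R78 F6 (c), seat abc-iut-w5-d171; no
interface clause touched): for ANY `D : ThetaSetting p`, a `ThetaSetting.KummerCore D` — a continuous
factorisation `augTheta : (Π^tp_X)^Θ → G_{ℚ_p}` of the augmentation, a BIJECTIVE equivariant coefficient map
`Λ(ℚ̄_p^×) = Ẑ(1) → Δ_Θ` (`CyclotomeCoefficients` of `KummerContH1.lean` for the action through `augTheta`),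
the Galois images `augTheta((Π^tp_Y)^Θ) = G_K`, `augTheta((Π^tp_Ÿ)^Θ) = G_K̈`, finiteness of `K̈/ℚ_p`, and the
two coordinate classes `log(U)`, `log(Ü)` with `log(U)|_Ÿ = 2·log(Ü)` — yields `KummerCore.toKummerData :
D.KummerData` whose Kummer maps are the tree's CONTINUOUS KUMMER MAP (`CyclotomeCoefficients.kummerContMap`)
on `KHat := (ℚ̄_p^×)^{(Π^tp_Y)^Θ} = K^×` (honest SUB-object of print's `(K^×)^∧`), injective by
`kummerContMap_injective` + the p-adic Kummer-faithfulness of abc-iut-L4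
(`divisibleElementsTrivial_units_of_finite_padic`), restriction-compatible by `res_kummerContMap`.
The χ-twisted root model (R78 F5) instantiates it (F6 part 2b). Semi-synthetic use; nothing of [EtTh] is
asserted; no side taken on [IUTchIII] Cor. 3.12. Definitions: `unitsAction`, `KummerCore`,
`KummerCore.invY/invYdd/toInvY/toInvYdd/toKummerData`; no instances on existing types, no Prop facts.
-/

noncomputable section

namespace Literature.AnabelianGeometry.EtaleTheta

open Literature.AnabelianGeometry.SemiGraphs Literature.NumberTheory.GaloisRepresentations

namespace ThetaSetting

variable {p : ℕ} [Fact p.Prime] (D : ThetaSetting p)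

/-- The action of `(Π^tp_X)^Θ` on `ℚ̄_p^×` through a homomorphism `ψ : (Π^tp_X)^Θ → G_{ℚ_p}` (a reducible
definition, used as a LOCAL instance only). [cite: MochizukiEtTh2009, Prop 1.3 p.21] -/
@[reducible] def unitsAction (ψ : D.GtpTheta →* GQp p) : MulDistribMulAction D.GtpTheta (PadicAlgCl p)ˣ :=
  MulDistribMulAction.compHom _ ψ

/-- **Kummer core** of a theta setting: the inputs from which the Kummer data of [EtTh] §1 are built by
Kummer theory — a continuous factorisation of the augmentation through the theta quotient, a bijective
equivariant identification `Ẑ(1) = Λ(ℚ̄_p^×) → Δ_Θ`, the Galois images of `(Π^tp_Y)^Θ`, `(Π^tp_Ÿ)^Θ`, and the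
coordinate classes `log(U)`, `log(Ü)`. [cite: MochizukiEtTh2009, Prop 1.5 p.23] -/
structure KummerCore where
  /-- `(Π^tp_X)^Θ → G_{ℚ_p}` -/
  augTheta : D.GtpTheta →* GQp p
  continuous_augTheta : Continuous augTheta
  /-- it factors the augmentation `Π^tp_X → G_{ℚ_p}` -/
  augTheta_toTheta : ∀ g : D.PiTemp, augTheta (D.toTheta g) = D.aug g
  /-- `Ẑ(1) = Λ(ℚ̄_p^×) → Δ_Θ` … -/
  coeffHom : cyclotome (PadicAlgCl p)ˣ →* D.DeltaTheta
  /-- … continuous (`Λ` with the subspace-of-product topology) … -/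
  continuous_coeffHom : Continuous coeffHom
  /-- … equivariant: `G_{ℚ_p}` acting on `Λ(ℚ̄_p^×)` through `augTheta`, `(Π^tp_X)^Θ` on `Δ_Θ` by conjugation
  (the cyclotomic character on `Δ_Θ ≅ Ẑ(1)`) … -/
  coeffHom_smul : ∀ (g : D.GtpTheta) (ζ : cyclotome (PadicAlgCl p)ˣ),
    coeffHom (augTheta g • ζ) = MulAut.conjNormal g (coeffHom ζ)
  /-- … and bijective (`Ẑ(1) ≅ Δ_Θ`). -/
  bijective_coeffHom : Function.Bijective coeffHom
  /-- `augTheta((Π^tp_Y)^Θ) = G_K` -/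
  map_augTheta_gtpY : (D.GtpY.map D.toTheta).map augTheta = D.K.fixingSubgroup
  /-- `augTheta((Π^tp_Ÿ)^Θ) = G_K̈` -/
  map_augTheta_gtpYdd : (D.GtpYdd.map D.toTheta).map augTheta = D.Kdd.fixingSubgroup
  /-- `K̈/ℚ_p` is finite -/
  finiteDimensional_Kdd : FiniteDimensional ℚ_[p] D.Kdd
  /-- `log(U)` -/
  logU : D.H1Theta (D.GtpY.map D.toTheta)
  /-- `log(Ü)` -/
  logUdd : D.H1Theta (D.GtpYdd.map D.toTheta)
  /-- `log(U)|_Ÿ = 2 · log(Ü)` -/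
  res_logU : ContH1.res (MonoidHom.id D.GtpTheta) D.DeltaTheta D.GtpYddTheta_le logU = logUdd ^ 2

namespace KummerCore

variable {D} (C : D.KummerCore)

/-- The coefficient structure `Λ(ℚ̄_p^×) → Δ_Θ` of the tree's continuous Kummer theory (`KummerContH1.lean`),
for the action of `(Π^tp_X)^Θ` on `ℚ̄_p^×` through `augTheta`. [cite: MochizukiEtTh2009, Prop 1.3 p.21] -/
def coeff : @CyclotomeCoefficients D.GtpTheta D.GtpTheta _ _ _ (MonoidHom.id D.GtpTheta) D.DeltaTheta _
    (PadicAlgCl p)ˣ _ (D.unitsAction C.augTheta) _ :=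
  letI := D.unitsAction C.augTheta
  { hom := C.coeffHom
    continuous_hom := C.continuous_coeffHom
    hom_smul := fun g ζ => C.coeffHom_smul g ζ }

/-- Stabilisers of units for the action through `augTheta` are open. [cite: MochizukiEtTh2009, Prop 1.3 p.21] -/
theorem isOpen_stabilizer (b : (PadicAlgCl p)ˣ) :
    letI := D.unitsAction C.augTheta
    IsOpen (MulAction.stabilizer D.GtpTheta b : Set D.GtpTheta) := by
  letI := D.unitsAction C.augTheta
  have h : (MulAction.stabilizer D.GtpTheta b : Set D.GtpTheta) =
      C.augTheta ⁻¹' (MulAction.stabilizer (GQp p) b : Set (GQp p)) := by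
    ext g; rfl
  rw [h]
  exact (isOpen_stabilizer_absoluteGaloisGroup_units ℚ_[p] b).preimage C.continuous_augTheta

/-- The `(Π^tp_Y)^Θ`-invariant units `= K^×` inside `ℚ̄_p^×` — the carrier `KHat` (honest sub-object of
`(K^×)^∧`). [cite: MochizukiEtTh2009, Prop 1.5 p.23] -/
abbrev invY : Subgroup (PadicAlgCl p)ˣ :=
  letI := D.unitsAction C.augTheta
  invariants (A := (PadicAlgCl p)ˣ) (D.GtpY.map D.toTheta)

/-- The `(Π^tp_Ÿ)^Θ`-invariant units `= K̈^×` — the carrier `KddHat`. [cite: MochizukiEtTh2009, Prop 1.5 p.23] -/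
abbrev invYdd : Subgroup (PadicAlgCl p)ˣ :=
  letI := D.unitsAction C.augTheta
  invariants (A := (PadicAlgCl p)ˣ) (D.GtpYdd.map D.toTheta)

/-- Invariants through `augTheta` are the units fixed by the image subgroup of `G_{ℚ_p}`.
[cite: MochizukiEtTh2009, Prop 1.5 p.23] -/
theorem mem_invariants_iff (H : Subgroup D.GtpTheta) (u : (PadicAlgCl p)ˣ) :
    (letI := D.unitsAction C.augTheta; u ∈ invariants (A := (PadicAlgCl p)ˣ) H) ↔
      ∀ σ ∈ H.map C.augTheta, σ • u = u := by
  constructor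
  · rintro hu σ ⟨h, hh, rfl⟩
    exact hu ⟨h, hh⟩
  · intro hu h
    exact hu _ ⟨h.1, h.2, rfl⟩

/-- A unit fixed by `G_L` (`L` an intermediate field) lies in `L` (`ℚ̄_p/ℚ_p` is Galois).
[cite: MochizukiEtTh2009, Prop 1.5 p.23] -/
theorem coe_mem_of_forall_fixingSubgroup (L : IntermediateField ℚ_[p] (PadicAlgCl p)) (u : (PadicAlgCl p)ˣ)
    (hu : ∀ σ ∈ L.fixingSubgroup, σ • u = u) : (u : PadicAlgCl p) ∈ L := by
  have hfix := InfiniteGalois.fixedField_fixingSubgroup L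
  have : (u : PadicAlgCl p) ∈ IntermediateField.fixedField L.fixingSubgroup := by
    intro σ
    exact congrArg Units.val (hu σ.1 σ.2)
  rwa [hfix] at this

/-- Conversely units of `L` are fixed by `G_L`. [cite: MochizukiEtTh2009, Prop 1.5 p.23] -/
theorem smul_eq_of_coe_mem (L : IntermediateField ℚ_[p] (PadicAlgCl p)) (u : (PadicAlgCl p)ˣ)
    (hu : (u : PadicAlgCl p) ∈ L) : ∀ σ ∈ L.fixingSubgroup, σ • u = u := by
  intro σ hσ
  apply Units.ext
  exact (IntermediateField.mem_fixingSubgroup_iff _ _).mp hσ _ hu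

/-- **Kummer-faithfulness of the invariants**: an `H`-invariant unit with `H`-invariant `n`-th roots for
all `n`, where `augTheta(H) = G_L` for a FINITE extension `L/ℚ_p`, is trivial (`⋂_N (L^×)^N = 1`,
abc-iut-L4's `divisibleElementsTrivial_units_of_finite_padic`). [cite: MochizukiEtTh2009, Prop 1.5 p.23] -/
theorem invariants_kummerFaithful (H : Subgroup D.GtpTheta) (L : IntermediateField ℚ_[p] (PadicAlgCl p))
    [FiniteDimensional ℚ_[p] L] (hH : H.map C.augTheta = L.fixingSubgroup) :
    letI := D.unitsAction C.augTheta
    ∀ a : invariants (A := (PadicAlgCl p)ˣ) H,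
      (∀ n : ℕ+, ∃ b : invariants (A := (PadicAlgCl p)ˣ) H, b ^ (n : ℕ) = a) → a = 1 := by
  letI := D.unitsAction C.augTheta
  intro a ha
  have hmem : ∀ u : invariants (A := (PadicAlgCl p)ˣ) H, ((u : (PadicAlgCl p)ˣ) : PadicAlgCl p) ∈ L := by
    intro u
    apply coe_mem_of_forall_fixingSubgroup L
    rw [← hH]
    exact (C.mem_invariants_iff H u).mp u.2
  -- descend to `L^×`
  let toL : invariants (A := (PadicAlgCl p)ˣ) H → (↥L)ˣ := fun u =>
    Units.mk0 ⟨((u : (PadicAlgCl p)ˣ) : PadicAlgCl p), hmem u⟩ (by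
      intro h0
      apply (u : (PadicAlgCl p)ˣ).ne_zero
      exact congrArg Subtype.val h0)
  have htoL : ∀ u, (((toL u : (↥L)ˣ) : ↥L) : PadicAlgCl p) = ((u : (PadicAlgCl p)ˣ) : PadicAlgCl p) :=
    fun _ => rfl
  have hD := Literature.AnabelianGeometry.AbsoluteAnabelian.AbsTopIII.divisibleElementsTrivial_units_of_finite_padic
    p (↥L)
  have key : toL a = 1 := by
    refine hD.eq_one_of_forall_exists_pow _ fun n hn => ?_
    obtain ⟨b, hb⟩ := ha ⟨n, hn⟩
    refine ⟨toL b, Units.ext (Subtype.ext ?_)⟩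
    simp only [Units.val_pow_eq_pow_val, SubmonoidClass.coe_pow, htoL]
    have := congrArg (fun u : invariants (A := (PadicAlgCl p)ˣ) H => ((u : (PadicAlgCl p)ˣ) : PadicAlgCl p)) hb
    simpa using this
  apply Subtype.ext
  apply Units.ext
  have := congrArg (fun u : (↥L)ˣ => ((u : ↥L) : PadicAlgCl p)) key
  simpa [htoL] using this

/-- Open stabilisers, packaged as the hypothesis `hA` of `kummerContMap`. [cite: MochizukiEtTh2009, Prop 1.3 p.21] -/
theorem isOpen_stabilizer' :
    letI := D.unitsAction C.augTheta
    ∀ b : (PadicAlgCl p)ˣ, IsOpen (MulAction.stabilizer D.GtpTheta b : Set D.GtpTheta) :=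
  fun b => C.isOpen_stabilizer b

/-- `K^× → (ℚ̄_p^×)^{(Π^tp_Y)^Θ}`: a unit of `K` is fixed by `augTheta((Π^tp_Y)^Θ) = G_K`.
[cite: MochizukiEtTh2009, Prop 1.5 p.23] -/
def toInvY : (↥D.K)ˣ →* C.invY :=
  letI := D.unitsAction C.augTheta
  (Units.map (algebraMap (↥D.K) (PadicAlgCl p) : ↥D.K →* PadicAlgCl p)).codRestrict C.invY fun u =>
    (C.mem_invariants_iff _ _).mpr (by
      rw [C.map_augTheta_gtpY]
      exact smul_eq_of_coe_mem D.K _ (u : ↥D.K).2)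

/-- `K̈^× → (ℚ̄_p^×)^{(Π^tp_Ÿ)^Θ}`. [cite: MochizukiEtTh2009, Prop 1.5 p.23] -/
def toInvYdd : (↥D.Kdd)ˣ →* C.invYdd :=
  letI := D.unitsAction C.augTheta
  (Units.map (algebraMap (↥D.Kdd) (PadicAlgCl p) : ↥D.Kdd →* PadicAlgCl p)).codRestrict C.invYdd fun u =>
    (C.mem_invariants_iff _ _).mpr (by
      rw [C.map_augTheta_gtpYdd]
      exact smul_eq_of_coe_mem D.Kdd _ (u : ↥D.Kdd).2)

/-- [cite: MochizukiEtTh2009, Prop 1.5 p.23] -/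
theorem coe_toInvY (u : (↥D.K)ˣ) : (((C.toInvY u : C.invY) : (PadicAlgCl p)ˣ) : PadicAlgCl p) = ((u : ↥D.K) : PadicAlgCl p) :=
  rfl

/-- [cite: MochizukiEtTh2009, Prop 1.5 p.23] -/
theorem coe_toInvYdd (u : (↥D.Kdd)ˣ) :
    (((C.toInvYdd u : C.invYdd) : (PadicAlgCl p)ˣ) : PadicAlgCl p) = ((u : ↥D.Kdd) : PadicAlgCl p) :=
  rfl

/-- `K^× ⊆ KHat` is injective. [cite: MochizukiEtTh2009, Prop 1.5 p.23] -/
theorem toInvY_injective : Function.Injective C.toInvY := by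
  intro u v h
  have h1 := congrArg (fun w : C.invY => ((w : (PadicAlgCl p)ˣ) : PadicAlgCl p)) h
  simp only [coe_toInvY] at h1
  exact Units.ext (Subtype.ext h1)

/-- `K̈^× ⊆ KddHat` is injective. [cite: MochizukiEtTh2009, Prop 1.5 p.23] -/
theorem toInvYdd_injective : Function.Injective C.toInvYdd := by
  intro u v h
  have h1 := congrArg (fun w : C.invYdd => ((w : (PadicAlgCl p)ˣ) : PadicAlgCl p)) h
  simp only [coe_toInvYdd] at h1
  exact Units.ext (Subtype.ext h1)

/-- `(ℚ̄_p^×)^{(Π^tp_Y)^Θ} ≤ (ℚ̄_p^×)^{(Π^tp_Ÿ)^Θ}` (`Π^tp_Ÿ ≤ Π^tp_Y`). [cite: MochizukiEtTh2009, Prop 1.5 p.23] -/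
theorem invY_le_invYdd : C.invY ≤ C.invYdd := by
  letI := D.unitsAction C.augTheta
  exact CyclotomeCoefficients.invariants_anti (A := (PadicAlgCl p)ˣ) D.GtpYddTheta_le

/-- **The Kummer data of a Kummer core**: `KHat := K^× = (ℚ̄_p^×)^{(Π^tp_Y)^Θ}`, `KddHat := K̈^×`, the Kummer
injections `kumY`, `kumYdd` = the tree's continuous Kummer map with coefficients `Ẑ(1) ≅ Δ_Θ` (injective by
p-adic Kummer-faithfulness, restriction-compatible), and the given coordinate classes `log(U)`, `log(Ü)`.
Honest sub-object: print's `(K^×)^∧` is replaced by `K^× ⊆ (K^×)^∧`. [cite: MochizukiEtTh2009, Prop 1.5 p.23] -/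
def toKummerData : D.KummerData :=
  letI := D.unitsAction C.augTheta
  haveI : FiniteDimensional ℚ_[p] D.K := D.finiteDimensional_K
  haveI : FiniteDimensional ℚ_[p] D.Kdd := C.finiteDimensional_Kdd
  { KHat := C.invY
    KddHat := C.invYdd
    toKHat := C.toInvY
    toKddHat := C.toInvYdd
    toKHat_injective := C.toInvY_injective
    toKddHat_injective := C.toInvYdd_injective
    hatIncl := Subgroup.inclusion C.invY_le_invYdd
    hatIncl_toKHat := fun _ _ hxy => Subtype.ext (Units.ext hxy)
    kumY := C.coeff.kummerContMap (D.GtpY.map D.toTheta) C.isOpen_stabilizer'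
    kumY_injective :=
      C.coeff.kummerContMap_injective _ C.isOpen_stabilizer' C.bijective_coeffHom
        (C.invariants_kummerFaithful _ D.K C.map_augTheta_gtpY)
    kumYdd := C.coeff.kummerContMap (D.GtpYdd.map D.toTheta) C.isOpen_stabilizer'
    kumYdd_injective :=
      C.coeff.kummerContMap_injective _ C.isOpen_stabilizer' C.bijective_coeffHom
        (C.invariants_kummerFaithful _ D.Kdd C.map_augTheta_gtpYdd)
    res_kumY := fun x => C.coeff.res_kummerContMap D.GtpYddTheta_le C.isOpen_stabilizer' x
    logU := C.logU
    logUdd := C.logUdd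
    res_logU := C.res_logU }

/-- The Kummer map of the constructed data IS the continuous Kummer map of the tree.
[cite: MochizukiEtTh2009, Prop 1.5 p.23] -/
theorem toKummerData_kumY (x : C.invY) :
    C.toKummerData.kumY x =
      (letI := D.unitsAction C.augTheta
       C.coeff.kummerContMap (D.GtpY.map D.toTheta) C.isOpen_stabilizer' x) :=
  rfl

end KummerCore

/-- Hence every theta setting admitting a Kummer core carries Kummer data (NV of the E-indexed block of
[EtTh] §1 reduces to exhibiting a core, e.g. at the χ-twisted root model). [cite: MochizukiEtTh2009, Prop 1.5 p.23] -/
theorem nonempty_kummerData_of_kummerCore (C : D.KummerCore) : Nonempty D.KummerData := ⟨C.toKummerData⟩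

end ThetaSetting

end Literature.AnabelianGeometry.EtaleTheta

end
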